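import Literature.NumberTheory.Transcendental.PadicCW77Main
import Mathlib.NumberTheory.SiegelsLemma
import HarnessLib

/-!
# The `p`-adic Cijsouw–Waldschmidt descent: level `0` (Siegel's lemma)

Support file (definitions and proved theorems; no named fact), sequel to `PadicCW77Main.lean`
(cell `abc-stewartyu`, WP-A5): the input `PadicCW77.Setup.Siegel` of the composition `main` is
DISCHARGED here — `siegel_holds` — as the twin, on the sign-free rational cores of
`PadicCW77.Setup`, of the tree's `CW77.Setup.siegel_step` (Cijsouw–Waldschmidt 1977, §4 Step 1):
the clearing denominator `Dclear` (the frame's `ν^{τ₀} |b_θ|^{|τ'|}` times `∏ den αⱼ^{Lⱼ s} den θ^{L_θ s}`),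
the integrality `Dclear · qTerm ∈ ℤ` (`exists_int_qE`, `exists_int_Dclear_mul_qTerm` — the frame's
`exists_int_qΔ`, `exists_int_qA` are imported), and Siegel's lemma (Mathlib
`Int.Matrix.exists_ne_zero_int_vec_norm_le`) with exponent `1` when `#box₀ ≥ 2 #equations`.
The archimedean bound `Amax` on the cleared coefficients and the count are WP-A4's.

## References
* [CijsouwWaldschmidt1977] P. L. Cijsouw, M. Waldschmidt, Compositio Math. 34 (1977), §4 Step 1
  (pp. 185–186).
* [Waldschmidt1980] M. Waldschmidt, Acta Arith. 37 (1980), Lemma 3.2 (pp. 266–267).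
-/

noncomputable section

attribute [local instance] Matrix.seminormedAddCommGroup

open Finset
open Literature.NumberTheory.Transcendental.Baker1975.Ch3 (nuBound nuBound_pos)

namespace Literature.NumberTheory.Transcendental

namespace PadicCW77

open CW77.Setup (Idx Tau tauNorm tauSet mem_tauSet scale)

namespace Setup

variable (S : Setup) {h Lb : ℕ}

/-! ### The clearing denominator and integrality -/

/-- The clearing denominator of the equation `(s, τ)`:
`D(s,τ) = ν(2^{J₀}s, h)^{τ₀} · |b_θ|^{|τ'|} · (∏ⱼ den αⱼ^{Lⱼ s}) · den θ^{L_θ s}` (twin of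
`CW77.Setup.Dclear`). [cite: CijsouwWaldschmidt1977, §4 Step 1 (p. 185)] -/
def Dclear (J₀ : ℕ) (L : Fin S.d → ℕ) (Lθ : ℕ) (s : ℕ) (τ : Tau S.d) : ℕ :=
  nuBound (scale J₀ 0 * s) h ^ τ.1 * S.bθ.natAbs ^ (∑ j, τ.2 j) *
    ((∏ j, (S.α j).den ^ (L j * s)) * S.θ.den ^ (Lθ * s))

/-- `D(s,τ) > 0`. [cite: CijsouwWaldschmidt1977, §4 Step 1 (p. 185)] -/
theorem Dclear_pos (J₀ s : ℕ) (τ : Tau S.d) (L : Fin S.d → ℕ) (Lθ : ℕ) :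
    0 < S.Dclear (h := h) J₀ L Lθ s τ := by
  unfold Dclear
  refine Nat.mul_pos (Nat.mul_pos (Nat.pow_pos (nuBound_pos _ _)) (Nat.pow_pos ?_))
    (Nat.mul_pos ?_ (Nat.pow_pos S.θ.pos))
  · exact Int.natAbs_pos.mpr S.bθ_ne
  · exact prod_pos fun j _ => Nat.pow_pos (S.α j).pos

/-- `(∏ den αⱼ^{Lⱼ s}) den θ^{L_θ s} · qE ∈ ℤ` on the box (`λⱼ ≤ Lⱼ`, `λ_θ ≤ L_θ`) (twin of
`CW77.Setup.exists_int_qE`; the generators may be negative). [cite: CijsouwWaldschmidt1977, §4 Step 1 (p. 185)] -/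
theorem exists_int_qE (s : ℕ) {L : Fin S.d → ℕ} {Lθ : ℕ} {u : Idx S.d h Lb}
    (hu : (∀ j, u.2.1 j ≤ L j) ∧ u.2.2 ≤ Lθ) :
    ∃ z : ℤ, (((∏ j, (S.α j).den ^ (L j * s)) * S.θ.den ^ (Lθ * s) : ℕ) : ℚ) * S.qE u s = z := by
  unfold qE
  have hone : ∀ (q : ℚ) (lam Lq : ℕ), lam ≤ Lq →
      ∃ z : ℤ, ((q.den ^ (Lq * s) : ℕ) : ℚ) * q ^ (lam * s) = z := by
    intro q lam Lq hle
    refine ⟨(q.den : ℤ) ^ ((Lq - lam) * s) * q.num ^ (lam * s), ?_⟩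
    have hsplit : Lq * s = (Lq - lam) * s + lam * s := by rw [← add_mul, Nat.sub_add_cancel hle]
    rw [hsplit, pow_add]
    push_cast
    rw [mul_assoc, ← mul_pow, Rat.den_mul_eq_num]
  choose zα hzα using fun j => hone (S.α j) (u.2.1 j) (L j) (hu.1 j)
  obtain ⟨zθ, hzθ⟩ := hone S.θ u.2.2 Lθ hu.2
  refine ⟨(∏ j, zα j) * zθ, ?_⟩
  have hα' : ∏ j, ((((S.α j).den : ℚ)) ^ (L j * s) * (S.α j) ^ (u.2.1 j * s)) = ∏ j, (zα j : ℚ) :=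
    prod_congr rfl fun j _ => by exact_mod_cast hzα j
  push_cast at hzθ ⊢
  calc (∏ j, (((S.α j).den : ℚ)) ^ (L j * s)) * ((S.θ.den : ℚ)) ^ (Lθ * s) *
        ((∏ j, S.α j ^ (u.2.1 j * s)) * S.θ ^ (u.2.2 * s))
      = (∏ j, ((((S.α j).den : ℚ)) ^ (L j * s) * (S.α j) ^ (u.2.1 j * s))) *
          (((S.θ.den : ℚ)) ^ (Lθ * s) * S.θ ^ (u.2.2 * s)) := by rw [prod_mul_distrib]; ring
    _ = (∏ j, (zα j : ℚ)) * (zθ : ℚ) := by rw [hα', hzθ]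

/-- **The cleared coefficients are integers**: `D(s,τ) · qTerm ∈ ℤ` on the box of level `0`
(twin of `CW77.Setup.exists_int_Dclear_mul_qTerm`). [cite: CijsouwWaldschmidt1977, §4 Step 1 (p. 185)] -/
theorem exists_int_Dclear_mul_qTerm (J₀ : ℕ) {L : Fin S.d → ℕ} {Lθ : ℕ} {u : Idx S.d h Lb}
    (hu : u ∈ S.frame.box (h := h) (Lb := Lb) L Lθ 0) (τ : Tau S.d) (s : ℕ) :
    ∃ z : ℤ, ((S.Dclear (h := h) J₀ L Lθ s τ : ℕ) : ℚ) * S.qTerm J₀ 0 u τ s = z := by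
  rw [S.frame.mem_box] at hu
  simp only [pow_zero, Nat.div_one] at hu
  obtain ⟨z₁, hz₁⟩ := S.frame.exists_int_qΔ J₀ 0 u τ.1 s
  obtain ⟨z₂, hz₂⟩ := S.frame.exists_int_qA u τ.2
  obtain ⟨z₃, hz₃⟩ := S.exists_int_qE s hu
  refine ⟨z₁ * z₂ * z₃, ?_⟩
  unfold Dclear qTerm
  push_cast at hz₁ hz₂ hz₃ ⊢
  rw [← hz₁, ← hz₂, ← hz₃]
  ring

/-! ### The clearing denominator at level `J` (input `KSizes`, denominator part) -/

/-- The clearing denominator of `coreSum_{J,τ}(s)` on the box of level `J`: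
`D_J(s,τ) = ν(2^{J₀−J}s, h)^{τ₀} · |b_θ|^{|τ'|} · ∏ den(αⱼ)^{⌊Lⱼ/2^J⌋ s} · den(θ)^{⌊L_θ/2^J⌋ s}`
(twin of `CW77.Setup.DclearJ`; `Dclear` is the case `J = 0`).
[cite: Waldschmidt1980, Lemma 3.4 (p. 269)] -/
def DclearJ (J₀ J : ℕ) (L : Fin S.d → ℕ) (Lθ : ℕ) (s : ℕ) (τ : Tau S.d) : ℕ :=
  nuBound (scale J₀ J * s) h ^ τ.1 * S.bθ.natAbs ^ (∑ j, τ.2 j) *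
    ((∏ j, (S.α j).den ^ (L j / 2 ^ J * s)) * S.θ.den ^ (Lθ / 2 ^ J * s))

/-- `D_J(s,τ) > 0`. [cite: Waldschmidt1980, Lemma 3.4 (p. 269)] -/
theorem DclearJ_pos (J₀ J s : ℕ) (τ : Tau S.d) (L : Fin S.d → ℕ) (Lθ : ℕ) :
    0 < S.DclearJ (h := h) J₀ J L Lθ s τ := by
  unfold DclearJ
  refine Nat.mul_pos (Nat.mul_pos (Nat.pow_pos (nuBound_pos _ _)) (Nat.pow_pos ?_))
    (Nat.mul_pos ?_ (Nat.pow_pos S.θ.pos))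
  · exact Int.natAbs_pos.mpr S.bθ_ne
  · exact prod_pos fun j _ => Nat.pow_pos (S.α j).pos

/-- `D_J(s,τ) · qTerm_{J,τ}(u, s) ∈ ℤ` on the box of level `J`.
[cite: Waldschmidt1980, Lemma 3.4 (p. 269)] -/
theorem exists_int_DclearJ_mul_qTerm (J₀ J : ℕ) {L : Fin S.d → ℕ} {Lθ : ℕ} {u : Idx S.d h Lb}
    (hu : u ∈ S.frame.box (h := h) (Lb := Lb) L Lθ J) (τ : Tau S.d) (s : ℕ) :
    ∃ z : ℤ, ((S.DclearJ (h := h) J₀ J L Lθ s τ : ℕ) : ℚ) * S.qTerm J₀ J u τ s = z := by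
  rw [S.frame.mem_box] at hu
  obtain ⟨z₁, hz₁⟩ := S.frame.exists_int_qΔ J₀ J u τ.1 s
  obtain ⟨z₂, hz₂⟩ := S.frame.exists_int_qA u τ.2
  obtain ⟨z₃, hz₃⟩ := S.exists_int_qE s (L := fun j => L j / 2 ^ J) (Lθ := Lθ / 2 ^ J) hu
  refine ⟨z₁ * z₂ * z₃, ?_⟩
  unfold DclearJ qTerm
  push_cast at hz₁ hz₂ hz₃ ⊢
  rw [← hz₁, ← hz₂, ← hz₃]; ring

/-- **`D_J(s,τ) · coreSum_{J,τ}(s) ∈ ℤ`** for coefficients `p(u)` supported in the box of level `J`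
(the denominator part of the input `KSizes`). [cite: Waldschmidt1980, Lemma 3.4 (p. 269)] -/
theorem exists_int_DclearJ_mul_coreSum (J₀ J : ℕ) (L : Fin S.d → ℕ) (Lθ : ℕ)
    (p : Idx S.d h Lb → ℤ) (τ : Tau S.d) (s : ℕ) :
    ∃ m : ℤ, ((S.DclearJ (h := h) J₀ J L Lθ s τ : ℕ) : ℚ) *
      S.coreSum J₀ J (S.frame.box (h := h) (Lb := Lb) L Lθ J) p τ s = m := by
  classical
  have hint : ∀ u ∈ S.frame.box (h := h) (Lb := Lb) L Lθ J, ∃ z : ℤ,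
      ((S.DclearJ (h := h) J₀ J L Lθ s τ : ℕ) : ℚ) * S.qTerm J₀ J u τ s = z :=
    fun u hu => S.exists_int_DclearJ_mul_qTerm J₀ J hu τ s
  choose! z hz using hint
  refine ⟨∑ u ∈ S.frame.box (h := h) (Lb := Lb) L Lθ J, p u * z u, ?_⟩
  unfold coreSum
  rw [mul_sum]
  push_cast
  exact sum_congr rfl fun u hu => by rw [← hz u hu]; ring

/-- **`KSizes` from two archimedean bounds** (the form in which WP-A4 / the size junction supplies
it): with the clearing denominator `D := DclearJ` (which is positive and clears `coreSum`), it
suffices to bound `DclearJ J₀ J L L_θ s₁ τ ≤ Dmax k` and `|coreSum_{J,τ}(s₁)| ≤ Mmax k` on the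
relevant ranges. [cite: Waldschmidt1980, Lemma 3.4 (p. 269)] -/
theorem kSizes_of_bounds (J₀ J : ℕ) (L : Fin S.d → ℕ) (Lθ S₀ T t : ℕ) (p : Idx S.d h Lb → ℤ)
    (Dmax Mmax : ℕ → ℝ)
    (hD : ∀ k, k < S.d → ∀ τ : Tau S.d, tauNorm τ + t ≤ T / 2 ^ J - k * t →
      ∀ s₁, s₁ < 4 * (2 ^ (k + J) * S₀ / 2) → Odd s₁ →
        ((S.DclearJ (h := h) J₀ J L Lθ s₁ τ : ℕ) : ℝ) ≤ Dmax k)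
    (hM : ∀ k, k < S.d → ∀ τ : Tau S.d, tauNorm τ + t ≤ T / 2 ^ J - k * t →
      ∀ s₁, s₁ < 4 * (2 ^ (k + J) * S₀ / 2) → Odd s₁ →
        |(S.coreSum J₀ J (S.frame.box (h := h) (Lb := Lb) L Lθ J) p τ s₁ : ℝ)| ≤ Mmax k) :
    S.KSizes J₀ J L Lθ S₀ T t p Dmax Mmax := by
  intro k hk τ hτ s₁ hs₁ hodd
  exact ⟨S.DclearJ (h := h) J₀ J L Lθ s₁ τ, S.DclearJ_pos J₀ J s₁ τ L Lθ, hD k hk τ hτ s₁ hs₁ hodd,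
    S.exists_int_DclearJ_mul_coreSum J₀ J L Lθ p τ s₁, hM k hk τ hτ s₁ hs₁ hodd⟩

/-! ### Siegel's lemma -/

/-- **Step 1 (Siegel's lemma)** (twin of `CW77.Setup.siegel_step`). If there are at least twice as
many unknowns in the box of level `0` as equations `(s, τ)` (`s < S₀`, `|τ| < T`, `S₀, T ≥ 1`), and
the cleared coefficients are bounded by `Amax ≥ 1`, then there are integers `p(u)`, not all zero,
supported in the box, bounded by `⌈#box · Amax⌉`, satisfying all the relations of level `0`.
[cite: CijsouwWaldschmidt1977, §4 Step 1 (pp. 185–186)] [cite: Waldschmidt1980, Lemma 3.2 (p. 266)] -/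
theorem siegel_step (J₀ : ℕ) (L : Fin S.d → ℕ) (Lθ S₀ T : ℕ) (hS₀ : 1 ≤ S₀) (hT : 1 ≤ T)
    (hcard : 2 * ((range S₀) ×ˢ tauSet S.d T).card ≤ (S.frame.box (h := h) (Lb := Lb) L Lθ 0).card)
    {Amax : ℝ} (hAmax : 1 ≤ Amax)
    (hA : ∀ s, s < S₀ → ∀ τ : Tau S.d, tauNorm τ < T → ∀ u ∈ S.frame.box (h := h) (Lb := Lb) L Lθ 0,
      |((S.Dclear (h := h) J₀ L Lθ s τ : ℕ) : ℝ) * (S.qTerm J₀ 0 u τ s : ℝ)| ≤ Amax) :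
    ∃ p : Idx S.d h Lb → ℤ,
      S.Inv J₀ L Lθ S₀ T ⌈((S.frame.box (h := h) (Lb := Lb) L Lθ 0).card : ℝ) * Amax⌉ 0 p := by
  classical
  set boxZ := S.frame.box (h := h) (Lb := Lb) L Lθ 0 with hboxZ
  set eqs := (range S₀) ×ˢ tauSet S.d T with heqs
  -- the integer matrix
  have hint : ∀ (e : eqs) (u : boxZ), ∃ z : ℤ,
      ((S.Dclear (h := h) J₀ L Lθ e.1.1 e.1.2 : ℕ) : ℚ) * S.qTerm J₀ 0 u.1 e.1.2 e.1.1 = z :=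
    fun e u => S.exists_int_Dclear_mul_qTerm J₀ u.2 e.1.2 e.1.1
  choose Az hAz using hint
  set A : Matrix eqs boxZ ℤ := Matrix.of fun e u => Az e u with hAdef
  -- cardinalities
  have hm : 0 < Fintype.card eqs := by
    rw [Fintype.card_coe]
    refine Finset.card_pos.mpr ⟨(0, ((0 : ℕ), (0 : Fin S.d → ℕ))), ?_⟩
    rw [heqs, mem_product, mem_range, mem_tauSet]
    unfold tauNorm
    simpa using ⟨hS₀, hT⟩
  have hn : Fintype.card eqs < Fintype.card boxZ := by
    rw [Fintype.card_coe, Fintype.card_coe]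
    have : 0 < eqs.card := by rwa [Fintype.card_coe] at hm
    omega
  obtain ⟨t, ht0, hAt, htnorm⟩ := Int.Matrix.exists_ne_zero_int_vec_norm_le A hn hm
  -- entries of `A` are bounded by `Amax`, hence `‖t‖ ≤ #box · Amax`
  have hAnorm : ‖A‖ ≤ Amax := by
    rw [Matrix.norm_le_iff (by linarith)]
    intro e u
    have h1 := hAz e u
    have hmem : (e : ℕ × Tau S.d) ∈ range S₀ ×ˢ tauSet S.d T := e.2
    rw [mem_product, mem_range, mem_tauSet] at hmem
    have h2 := hA e.1.1 hmem.1 e.1.2 hmem.2 u.1 u.2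
    have hcast : ((S.Dclear (h := h) J₀ L Lθ e.1.1 e.1.2 : ℕ) : ℝ) * (S.qTerm J₀ 0 u.1 e.1.2 e.1.1 : ℝ) =
        ((Az e u : ℤ) : ℝ) := by
      have := congrArg (fun q : ℚ => (q : ℝ)) h1
      push_cast at this
      exact this
    rw [hAdef, Matrix.of_apply, Int.norm_eq_abs]
    rwa [hcast] at h2
  have htle : ∀ u : boxZ, |(t u : ℝ)| ≤ (boxZ.card : ℝ) * Amax := by
    intro u
    have h1 : ‖t u‖ ≤ ‖t‖ := norm_le_pi_norm t u
    rw [Int.norm_eq_abs] at h1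
    refine h1.trans (htnorm.trans ?_)
    have hbase : (1 : ℝ) ≤ (Fintype.card boxZ : ℝ) * max 1 ‖A‖ := by
      have : (1 : ℝ) ≤ Fintype.card boxZ := by exact_mod_cast (show 1 ≤ Fintype.card boxZ by omega)
      nlinarith [le_max_left (1 : ℝ) ‖A‖]
    have hexp : (Fintype.card eqs : ℝ) / (Fintype.card boxZ - Fintype.card eqs) ≤ 1 := by
      rw [div_le_one (by rw [sub_pos]; exact_mod_cast hn)]
      have : 2 * (Fintype.card eqs : ℝ) ≤ Fintype.card boxZ := by
        rw [Fintype.card_coe, Fintype.card_coe]; exact_mod_cast hcard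
      linarith
    calc ((Fintype.card boxZ : ℝ) * max 1 ‖A‖) ^ ((Fintype.card eqs : ℝ) / (Fintype.card boxZ - Fintype.card eqs))
        ≤ ((Fintype.card boxZ : ℝ) * max 1 ‖A‖) ^ (1 : ℝ) :=
          Real.rpow_le_rpow_of_exponent_le hbase hexp
      _ = (Fintype.card boxZ : ℝ) * max 1 ‖A‖ := Real.rpow_one _
      _ ≤ (boxZ.card : ℝ) * Amax := by
          rw [Fintype.card_coe]
          exact mul_le_mul_of_nonneg_left (max_le hAmax hAnorm) (by positivity)
  -- the vector `p`
  set p : Idx S.d h Lb → ℤ := fun u => if hu : u ∈ boxZ then t ⟨u, hu⟩ else 0 with hp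
  have hp_mem : ∀ u (hu : u ∈ boxZ), p u = t ⟨u, hu⟩ := fun u hu => by simp only [hp, dif_pos hu]
  refine ⟨p, ⟨?_, ?_, ?_, ?_⟩⟩
  · -- support
    intro u hu
    by_contra hnot
    exact hu (dif_neg hnot)
  · -- not all zero
    obtain ⟨u, hu⟩ := Function.ne_iff.mp ht0
    refine ⟨u.1, ?_⟩
    rw [hp_mem u.1 u.2]; exact hu
  · -- bound
    intro u
    by_cases hu : u ∈ boxZ
    · rw [hp_mem u hu]
      have h1 := htle ⟨u, hu⟩
      have h2 : ((t ⟨u, hu⟩ : ℤ) : ℝ) ≤ ⌈(boxZ.card : ℝ) * Amax⌉ :=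
        (le_abs_self _).trans (h1.trans (Int.le_ceil _))
      have h3 : (-(t ⟨u, hu⟩ : ℤ) : ℝ) ≤ ⌈(boxZ.card : ℝ) * Amax⌉ :=
        (neg_le_abs _).trans (h1.trans (Int.le_ceil _))
      rw [abs_le]
      constructor
      · have : -(⌈(boxZ.card : ℝ) * Amax⌉ : ℤ) ≤ t ⟨u, hu⟩ := by
          exact_mod_cast (by linarith : (-(⌈(boxZ.card : ℝ) * Amax⌉ : ℤ) : ℝ) ≤ t ⟨u, hu⟩)
        exact this
      · exact_mod_cast h2
    · simp only [hp, dif_neg hu, abs_zero]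
      exact Int.ceil_nonneg (by positivity)
  · -- relations
    intro s hs _hodd τ hτ
    rw [pow_zero, one_mul] at hs
    rw [pow_zero, Nat.div_one] at hτ
    have hmem : (s, τ) ∈ eqs := by
      rw [heqs, mem_product, mem_range, mem_tauSet]; exact ⟨hs, hτ⟩
    have hrow := congrFun hAt ⟨(s, τ), hmem⟩
    simp only [Matrix.mulVec, dotProduct, Pi.zero_apply] at hrow
    -- cast to `ℚ` and insert the coefficients
    have hD : ((S.Dclear (h := h) J₀ L Lθ s τ : ℕ) : ℚ) ≠ 0 := by
      exact_mod_cast (S.Dclear_pos J₀ s τ L Lθ).ne'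
    have hsum : ((S.Dclear (h := h) J₀ L Lθ s τ : ℕ) : ℚ) * S.coreSum J₀ 0 boxZ p τ s =
        ((∑ u : boxZ, A ⟨(s, τ), hmem⟩ u * t u : ℤ) : ℚ) := by
      unfold coreSum
      rw [mul_sum, ← Finset.sum_coe_sort boxZ]
      push_cast
      refine sum_congr rfl fun u _ => ?_
      rw [hAdef, Matrix.of_apply, ← hAz ⟨(s, τ), hmem⟩ u, hp_mem u.1 u.2]
      simp only; ring
    rw [hrow] at hsum
    simp only [Int.cast_zero, mul_eq_zero] at hsum
    exact hsum.resolve_left hD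

/-- **The input `Siegel` of `PadicCW77.Setup.main` holds** under the count `#box₀ ≥ 2 #equations`
and a bound `Amax` for the cleared coefficients (WP-A4 supplies both, with `P = ⌈#box₀ · Amax⌉`).
[cite: Waldschmidt1980, Lemma 3.2 (p. 266)] -/
theorem siegel_holds (J₀ : ℕ) (L : Fin S.d → ℕ) (Lθ S₀ T : ℕ) (hS₀ : 1 ≤ S₀) (hT : 1 ≤ T)
    (hcard : 2 * ((range S₀) ×ˢ tauSet S.d T).card ≤ (S.frame.box (h := h) (Lb := Lb) L Lθ 0).card)
    {Amax : ℝ} (hAmax : 1 ≤ Amax)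
    (hA : ∀ s, s < S₀ → ∀ τ : Tau S.d, tauNorm τ < T → ∀ u ∈ S.frame.box (h := h) (Lb := Lb) L Lθ 0,
      |((S.Dclear (h := h) J₀ L Lθ s τ : ℕ) : ℝ) * (S.qTerm J₀ 0 u τ s : ℝ)| ≤ Amax) :
    S.Siegel (h := h) (Lb := Lb) J₀ L Lθ S₀ T ⌈((S.frame.box (h := h) (Lb := Lb) L Lθ 0).card : ℝ) * Amax⌉ :=
  S.siegel_step J₀ L Lθ S₀ T hS₀ hT hcard hAmax hA

end Setup

end PadicCW77

end Literature.NumberTheory.Transcendental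

end
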